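import Mathlib

/-!
# Manin–Gamma cell (pub-manin-gamma0): square roots of 1 modulo an odd prime power (seat p1, gen 2) — group core of Lemma 4.4(i)

`proofs/T1_lead.md` Lemma 4.4(i) / `proofs/AppA_descent_lead.md` §B(i): for an odd prime `p`, `(ℤ/p^e)^×` has exactly ONE
character of order 2 (so ℚ(ζ_{p^e}) has exactly one quadratic subfield, = ℚ(√p*) by the Gauss sum). By `|G/G²| = |G[2]|`
(TorsionCount) the character count equals the number of square roots of unity; this file proves the arithmetic core:
`x² ≡ 1 (mod p^e)`, `p` an odd prime ⟹ `x ≡ ±1 (mod p^e)` — exactly two square roots of unity.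

* `ManinGamma.OddPrimePowSquareRoots.sq_eq_one_mod_odd_prime_pow`
Only Mathlib is imported; no `sorry`.
-/

namespace ManinGamma.OddPrimePowSquareRoots

/-- For an odd prime `p` and any `e`: `x² ≡ 1 (mod p^e)` implies `x ≡ 1` or `x ≡ −1 (mod p^e)`. -/
theorem sq_eq_one_mod_odd_prime_pow {p : ℕ} (hp : p.Prime) (hodd : p ≠ 2) (e : ℕ) {x : ℤ}
    (hx : x ^ 2 ≡ 1 [ZMOD (p : ℤ) ^ e]) :
    x ≡ 1 [ZMOD (p : ℤ) ^ e] ∨ x ≡ -1 [ZMOD (p : ℤ) ^ e] := by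
  have hpZ : Prime (p : ℤ) := Nat.prime_iff_prime_int.mp hp
  have hdvd : (p : ℤ) ^ e ∣ (x - 1) * (x + 1) := by
    have h := Int.modEq_iff_dvd.mp hx.symm
    rwa [show x ^ 2 - 1 = (x - 1) * (x + 1) by ring] at h
  -- p cannot divide both x - 1 and x + 1 (their difference is 2 and p is odd)
  by_cases h1 : (p : ℤ) ∣ x - 1
  · -- then p ∤ x + 1, so p^e is coprime to x + 1 and divides x - 1
    have h2 : ¬ (p : ℤ) ∣ x + 1 := by
      intro h2
      have h3 : (p : ℤ) ∣ 2 := by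
        have := dvd_sub h2 h1
        rwa [show x + 1 - (x - 1) = (2 : ℤ) by ring] at this
      have h4 : p ∣ 2 := by exact_mod_cast h3
      have := (Nat.prime_dvd_prime_iff_eq hp Nat.prime_two).mp h4
      exact hodd this
    have hcop : IsCoprime ((p : ℤ) ^ e) (x + 1) :=
      IsCoprime.pow_left ((Prime.coprime_iff_not_dvd hpZ).mpr h2)
    left
    rw [Int.modEq_iff_dvd]
    have := hcop.dvd_of_dvd_mul_right hdvd
    rwa [show (1 : ℤ) - x = -(x - 1) by ring, dvd_neg]
  · -- p ∤ x - 1: p^e coprime to x - 1, divides x + 1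
    have hcop : IsCoprime ((p : ℤ) ^ e) (x - 1) :=
      IsCoprime.pow_left ((Prime.coprime_iff_not_dvd hpZ).mpr h1)
    right
    rw [Int.modEq_iff_dvd]
    have := hcop.dvd_of_dvd_mul_left hdvd
    rwa [show (-1 : ℤ) - x = -(x + 1) by ring, dvd_neg]

end ManinGamma.OddPrimePowSquareRoots
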